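import Literature.NumberTheory.EllipticCurves.PointCountHasseInvariantProofs
import Literature.NumberTheory.EllipticCurves.VariableChangePoints
import Mathlib.AlgebraicGeometry.EllipticCurve.NormalForms
import Mathlib.Data.Nat.Prime.Factorial
import HarnessLib

/-!
# `j = 0` (resp. `j = 1728`) elliptic curves over the prime field `𝔽_p`, `p ≥ 5`, are ORDINARY when
# `p ≡ 1 (mod 3)` (resp. `p ≡ 1 (mod 4)`) (Silverman AEC V.4.1(a), Examples V.4.4–4.5; Deuring)

Topic `NumberTheory/EllipticCurves`; theorems only (no definition, no named fact, no instance).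

For an elliptic curve `E` over a finite field `K` with `p = #K` elements (`p ≥ 5` prime, so `K ≅ 𝔽_p`) and `j(E) = 0`:
if `p ≡ 1 (mod 3)` then `p ∤ p + 1 − #E(K)` (`not_dvd_trace_of_j_eq_zero_of_mod_three`), i.e. `E` is ordinary;
and for `j(E) = 1728`, `p ≡ 1 (mod 4)`: `not_dvd_trace_of_j_eq_1728_of_mod_four` (coefficient `4^m·C(m, m/2)·A^{m/2}`).
Proof: pass to a short model `y² = x³ + B` (`toShortNF`; `j = 0 ⇒ a₄ = 0`; point counts are invariant under a
`K`-isomorphism, tree `VariableChange.pointEquiv`); by AEC V.4.1(a) (tree `cast_card_add_one_sub_natCard_point`) the trace is,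
in `K`, the coefficient of `x^{p−1}` in `(4(x³ + B))^{(p−1)/2}`, namely `4^m·C(m, (p−1)/3)·B^{m−(p−1)/3} ≠ 0`
(`m = (p−1)/2 < p`). (Example V.4.4: `y² = x³ + B` is supersingular iff `p ≡ 2 (mod 3)` — the ordinary half.)

Motivation (BSD crux K★ `stmt-BirchSwinnertonDyer-22226`, hDR programme item (c)): the potentially good reduction of a
curve `W/ℚ` of Kodaira type IV* or II* at `p ≥ 5`, taken over `ℚ(ζ_p)` (residue field `𝔽_p`), has `j̃ = 0`; for
`p ≡ 1 (mod 3)` it is ordinary; type III* gives `j̃ = 1728`, ordinary for `p ≡ 1 (mod 4)` — the unit-root half of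
`HasPotentiallyGoodOrdinaryReductionAtPrime` for the K★ cells `(7, IV*)`, `(7, II*)`, `(5, III*)`. BSD is not proved by any of this.

## References

* [SilvermanAEC2009] J. H. Silverman, *AEC* (2009), Thm. V.4.1(a), Example V.4.4.
-/

noncomputable section

open scoped Classical
open Polynomial

namespace WeierstrassCurve

variable {K : Type*} [Field K]

/-- The `2`-torsion polynomial of a SHORT model: `Ψ₂² = 4(x³ + a₄x + a₆)`. [folklore] -/
private theorem twoTorsionPolynomial_toPoly_of_isShortNF (W : WeierstrassCurve K) [W.IsShortNF] :
    W.twoTorsionPolynomial.toPoly =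
      Polynomial.C (4 : K) * (X ^ 3 + Polynomial.C W.a₄ * X + Polynomial.C W.a₆) := by
  have hb₂ : W.b₂ = 0 := by rw [b₂, a₁_of_isShortNF, a₂_of_isShortNF]; ring
  have hb₄ : 2 * W.b₄ = 4 * W.a₄ := by rw [b₄, a₁_of_isShortNF, a₃_of_isShortNF]; ring
  have hb₆ : W.b₆ = 4 * W.a₆ := by rw [b₆, a₃_of_isShortNF]; ring
  rw [twoTorsionPolynomial, Cubic.toPoly]
  dsimp only
  rw [hb₂, hb₄, hb₆, map_zero, zero_mul, add_zero, map_mul, map_mul]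
  ring

/-- A binomial coefficient `C(m, k)` with `k ≤ m < p` is non-zero modulo the prime `p`. [folklore] -/
private theorem cast_choose_ne_zero {p : ℕ} [hp : Fact p.Prime] [CharP K p] {m k : ℕ} (hm : m < p) (hk : k ≤ m) :
    ((m.choose k : ℕ) : K) ≠ 0 := by
  rw [Ne, CharP.cast_eq_zero_iff K p]
  intro hdvd
  have h1 : p ∣ m.factorial := by
    have h := Nat.choose_mul_factorial_mul_factorial hk
    rw [mul_assoc] at h
    rw [← h]
    exact dvd_mul_of_dvd_left hdvd _
  exact absurd ((Nat.Prime.dvd_factorial hp.out).1 h1) (not_le.2 hm)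

/-- A natural number `0 < n < p` is non-zero in characteristic `p`. [folklore] -/
private theorem natCast_ne_zero_of_lt {p : ℕ} [CharP K p] {n : ℕ} (hn0 : n ≠ 0) (hn : n < p) :
    ((n : ℕ) : K) ≠ 0 := by
  rw [Ne, CharP.cast_eq_zero_iff K p]
  exact fun h => absurd (Nat.le_of_dvd (Nat.pos_of_ne_zero hn0) h) (not_le.2 hn)

/-- The coefficient of `x^{3 i₀}` in `(x³ + b)^m` is `b^{m − i₀}·C(m, i₀)` (`i₀ ≤ m`). [folklore] -/
private theorem coeff_X_pow_three_add_C_pow (b : K) {m i₀ : ℕ} (hi₀ : i₀ ≤ m) :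
    ((X ^ 3 + Polynomial.C b) ^ m).coeff (3 * i₀) = b ^ (m - i₀) * (m.choose i₀ : K) := by
  rw [add_pow, Polynomial.finsetSum_coeff]
  have hterm : ∀ k ∈ Finset.range (m + 1),
      ((X ^ 3) ^ k * Polynomial.C b ^ (m - k) * (m.choose k : K[X])).coeff (3 * i₀) =
        if k = i₀ then b ^ (m - i₀) * (m.choose i₀ : K) else 0 := by
    intro k _
    have hrw : (X ^ 3) ^ k * Polynomial.C b ^ (m - k) * (m.choose k : K[X]) =
        Polynomial.C (b ^ (m - k) * (m.choose k : K)) * X ^ (3 * k) := by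
      rw [← pow_mul, ← map_pow, ← map_natCast Polynomial.C (m.choose k), map_mul]
      ring
    rw [hrw, Polynomial.coeff_C_mul_X_pow]
    by_cases hk : k = i₀
    · subst hk; simp
    · rw [if_neg (by omega), if_neg hk]
  rw [Finset.sum_congr rfl hterm, Finset.sum_ite_eq' (Finset.range (m + 1)) i₀, if_pos (Finset.mem_range.2 (by omega))]

/-- **`j = 0`, `p ≡ 1 (mod 3)` ⇒ ordinary** over the prime field: for an elliptic curve `E` over a field `K` with `p ≥ 5`
elements, `j(E) = 0` and `p ≡ 1 (mod 3)` imply `p ∤ p + 1 − #E(K)`.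
[cite: SilvermanAEC2009, Thm. V.4.1(a) and Example V.4.4] -/
theorem not_dvd_trace_of_j_eq_zero_of_mod_three [Fintype K] (W : WeierstrassCurve K) [W.IsElliptic]
    {p : ℕ} [hp : Fact p.Prime] [CharP K p] (hcard : Fintype.card K = p) (hp5 : 5 ≤ p) (hmod : p % 3 = 1)
    (hj : W.j = 0) : ¬ ((p : ℤ) ∣ (Fintype.card K : ℤ) + 1 - Nat.card W.toAffine.Point) := by
  -- a short model `y² = x³ + B`
  have h2K : (2 : K) ≠ 0 := by
    have h := natCast_ne_zero_of_lt (K := K) (p := p) (n := 2) (by norm_num) (by omega)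
    exact_mod_cast h
  have h3K : (3 : K) ≠ 0 := by
    have h := natCast_ne_zero_of_lt (K := K) (p := p) (n := 3) (by norm_num) (by omega)
    exact_mod_cast h
  letI : Invertible (2 : K) := invertibleOfNonzero h2K
  letI : Invertible (3 : K) := invertibleOfNonzero h3K
  haveI : (W.toShortNF • W).IsShortNF := W.toShortNF_spec
  have hN : Nat.card (W.toShortNF • W).toAffine.Point = Nat.card W.toAffine.Point :=
    (Nat.card_congr (VariableChange.pointEquiv W W.toShortNF).toEquiv).symm
  rw [← hN, hcard]
  have hj' : (W.toShortNF • W).j = 0 := (variableChange_j W W.toShortNF).trans hj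
  have ha₄ : (W.toShortNF • W).a₄ = 0 := by
    have hc₄ : (W.toShortNF • W).c₄ = 0 := (j_eq_zero_iff _).1 hj'
    rw [c₄_of_isShortNF] at hc₄
    have h48 : (-48 : K) ≠ 0 := by
      have h' : (48 : K) ≠ 0 := by
        rw [show (48 : K) = 2 ^ 4 * 3 by norm_num]
        exact mul_ne_zero (pow_ne_zero _ h2K) h3K
      exact neg_ne_zero.2 h'
    exact (mul_eq_zero.1 hc₄).resolve_left h48
  have ha₆ : (W.toShortNF • W).a₆ ≠ 0 := by
    intro h0
    have hΔ : (W.toShortNF • W).Δ ≠ 0 := (W.toShortNF • W).isUnit_Δ.ne_zero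
    rw [Δ_of_isShortNF, ha₄, h0] at hΔ
    exact hΔ (by ring)
  -- AEC V.4.1(a): `a ≡ A_p`, the coefficient of `x^{p-1}` in `Ψ₂²^{(p-1)/2}`
  have hchar : ringChar K ≠ 2 := by
    rw [ringChar.eq K p]
    omega
  have key := (W.toShortNF • W).cast_card_add_one_sub_natCard_point hchar
  rw [hcard, twoTorsionPolynomial_toPoly_of_isShortNF, ha₄, map_zero, zero_mul, add_zero] at key
  -- the coefficient is `4^m · B^{m - i₀} · C(m, i₀)` with `m = (p-1)/2`, `i₀ = (p-1)/3`
  have h3dvd : 3 ∣ p - 1 := by omega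
  have hi3 : 3 * ((p - 1) / 3) = p - 1 := Nat.mul_div_cancel' h3dvd
  have hi₀m : (p - 1) / 3 ≤ (p - 1) / 2 := by omega
  have hcoeff : ((Polynomial.C (4 : K) * (X ^ 3 + Polynomial.C (W.toShortNF • W).a₆)) ^ ((p - 1) / 2)).coeff (p - 1) =
      (4 : K) ^ ((p - 1) / 2) * ((W.toShortNF • W).a₆ ^ ((p - 1) / 2 - (p - 1) / 3) *
        (((p - 1) / 2).choose ((p - 1) / 3) : K)) := by
    have hc := coeff_X_pow_three_add_C_pow ((W.toShortNF • W).a₆) hi₀m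
    rw [hi3] at hc
    rw [mul_pow, ← map_pow, Polynomial.coeff_C_mul, hc]
  rw [hcoeff] at key
  have hne : (4 : K) ^ ((p - 1) / 2) * ((W.toShortNF • W).a₆ ^ ((p - 1) / 2 - (p - 1) / 3) *
      (((p - 1) / 2).choose ((p - 1) / 3) : K)) ≠ 0 := by
    refine mul_ne_zero (pow_ne_zero _ ?_) (mul_ne_zero (pow_ne_zero _ ha₆) ?_)
    · have h : ((4 : ℕ) : K) ≠ 0 := natCast_ne_zero_of_lt (K := K) (p := p) (by norm_num) (by omega)
      exact_mod_cast h
    · exact cast_choose_ne_zero (K := K) (p := p) (by omega) hi₀m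
  rw [← key] at hne
  intro hdvd
  apply hne
  obtain ⟨c, hc⟩ := hdvd
  rw [hc, Int.cast_mul, Int.cast_natCast, CharP.cast_eq_zero K p, zero_mul]

/-- The coefficient of `x^{3k + (m-k)}`-terms: `(x³ + a x)^m = Σ_k C(m,k) a^{m−k} x^{m + 2k}`, so the coefficient of
`x^{2m}` (`m` even) is `a^{m/2}·C(m, m/2)`. [folklore] -/
private theorem coeff_X_pow_three_add_C_mul_X_pow (a : K) {m : ℕ} (hm : Even m) :
    ((X ^ 3 + Polynomial.C a * X) ^ m).coeff (2 * m) = a ^ (m - m / 2) * (m.choose (m / 2) : K) := by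
  rw [add_pow, Polynomial.finsetSum_coeff]
  have hterm : ∀ k ∈ Finset.range (m + 1),
      ((X ^ 3) ^ k * (Polynomial.C a * X) ^ (m - k) * (m.choose k : K[X])).coeff (2 * m) =
        if k = m / 2 then a ^ (m - m / 2) * (m.choose (m / 2) : K) else 0 := by
    intro k hk
    have hkm : k ≤ m := Nat.lt_succ_iff.mp (Finset.mem_range.mp hk)
    have hrw : (X ^ 3) ^ k * (Polynomial.C a * X) ^ (m - k) * (m.choose k : K[X]) =
        Polynomial.C (a ^ (m - k) * (m.choose k : K)) * X ^ (3 * k + (m - k)) := by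
      rw [← pow_mul, mul_pow, ← map_pow, ← map_natCast Polynomial.C (m.choose k), map_mul, pow_add]
      ring
    rw [hrw, Polynomial.coeff_C_mul_X_pow]
    by_cases hk' : k = m / 2
    · subst hk'
      obtain ⟨r, hr⟩ := hm
      have h1 : 2 * m = 3 * (m / 2) + (m - m / 2) := by omega
      rw [if_pos h1, if_pos rfl]
    · rw [if_neg (by omega), if_neg hk']
  rw [Finset.sum_congr rfl hterm, Finset.sum_ite_eq' (Finset.range (m + 1)) (m / 2),
    if_pos (Finset.mem_range.2 (by omega))]

/-- **`j = 1728`, `p ≡ 1 (mod 4)` ⇒ ordinary** over the prime field: for an elliptic curve `E` over a field `K` with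
`p ≥ 5` elements, `j(E) = 1728` and `p ≡ 1 (mod 4)` imply `p ∤ p + 1 − #E(K)`.
[cite: SilvermanAEC2009, Thm. V.4.1(a) and Example V.4.5] -/
theorem not_dvd_trace_of_j_eq_1728_of_mod_four [Fintype K] (W : WeierstrassCurve K) [W.IsElliptic]
    {p : ℕ} [hp : Fact p.Prime] [CharP K p] (hcard : Fintype.card K = p) (hp5 : 5 ≤ p) (hmod : p % 4 = 1)
    (hj : W.j = 1728) : ¬ ((p : ℤ) ∣ (Fintype.card K : ℤ) + 1 - Nat.card W.toAffine.Point) := by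
  have h2K : (2 : K) ≠ 0 := by
    have h := natCast_ne_zero_of_lt (K := K) (p := p) (n := 2) (by norm_num) (by omega)
    exact_mod_cast h
  have h3K : (3 : K) ≠ 0 := by
    have h := natCast_ne_zero_of_lt (K := K) (p := p) (n := 3) (by norm_num) (by omega)
    exact_mod_cast h
  letI : Invertible (2 : K) := invertibleOfNonzero h2K
  letI : Invertible (3 : K) := invertibleOfNonzero h3K
  haveI : (W.toShortNF • W).IsShortNF := W.toShortNF_spec
  have hN : Nat.card (W.toShortNF • W).toAffine.Point = Nat.card W.toAffine.Point :=
    (Nat.card_congr (VariableChange.pointEquiv W W.toShortNF).toEquiv).symm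
  rw [← hN, hcard]
  have hj' : (W.toShortNF • W).j = 1728 := (variableChange_j W W.toShortNF).trans hj
  have hΔ : (W.toShortNF • W).Δ ≠ 0 := (W.toShortNF • W).isUnit_Δ.ne_zero
  -- `j = 1728 ⇒ c₆ = 0 ⇒ a₆ = 0`
  have hjΔ : (W.toShortNF • W).j * (W.toShortNF • W).Δ = (W.toShortNF • W).c₄ ^ 3 := by
    rw [WeierstrassCurve.j, ← WeierstrassCurve.coe_Δ', mul_comm, ← mul_assoc, Units.mul_inv, one_mul]
  have hc₆ : (W.toShortNF • W).c₆ = 0 := by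
    have hrel := (W.toShortNF • W).c_relation
    rw [hj'] at hjΔ
    have h : (W.toShortNF • W).c₆ ^ 2 = 0 := by linear_combination hrel - hjΔ
    exact pow_eq_zero_iff two_ne_zero |>.1 h
  have ha₆ : (W.toShortNF • W).a₆ = 0 := by
    rw [c₆_of_isShortNF] at hc₆
    have h864 : (-864 : K) ≠ 0 := by
      have h' : (864 : K) ≠ 0 := by
        rw [show (864 : K) = 2 ^ 5 * 3 ^ 3 by norm_num]
        exact mul_ne_zero (pow_ne_zero _ h2K) (pow_ne_zero _ h3K)
      exact neg_ne_zero.2 h'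
    exact (mul_eq_zero.1 hc₆).resolve_left h864
  have ha₄ : (W.toShortNF • W).a₄ ≠ 0 := by
    intro h0
    rw [Δ_of_isShortNF, ha₆, h0] at hΔ
    exact hΔ (by ring)
  have hchar : ringChar K ≠ 2 := by
    rw [ringChar.eq K p]
    omega
  have key := (W.toShortNF • W).cast_card_add_one_sub_natCard_point hchar
  rw [hcard, twoTorsionPolynomial_toPoly_of_isShortNF, ha₆, map_zero, add_zero] at key
  -- the coefficient of `x^{p-1} = x^{2m}` in `(4(x³ + a x))^m` is `4^m · a^{m/2} · C(m, m/2)`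
  have h4dvd : 4 ∣ p - 1 := by omega
  have hmeven : Even ((p - 1) / 2) := ⟨(p - 1) / 4, by omega⟩
  have hm2 : 2 * ((p - 1) / 2) = p - 1 := by omega
  have hcoeff : ((Polynomial.C (4 : K) * (X ^ 3 + Polynomial.C (W.toShortNF • W).a₄ * X)) ^ ((p - 1) / 2)).coeff (p - 1) =
      (4 : K) ^ ((p - 1) / 2) * ((W.toShortNF • W).a₄ ^ ((p - 1) / 2 - (p - 1) / 2 / 2) *
        (((p - 1) / 2).choose ((p - 1) / 2 / 2) : K)) := by
    have hc := coeff_X_pow_three_add_C_mul_X_pow ((W.toShortNF • W).a₄) hmeven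
    rw [hm2] at hc
    rw [mul_pow, ← map_pow, Polynomial.coeff_C_mul, hc]
  rw [hcoeff] at key
  have hne : (4 : K) ^ ((p - 1) / 2) * ((W.toShortNF • W).a₄ ^ ((p - 1) / 2 - (p - 1) / 2 / 2) *
      (((p - 1) / 2).choose ((p - 1) / 2 / 2) : K)) ≠ 0 := by
    refine mul_ne_zero (pow_ne_zero _ ?_) (mul_ne_zero (pow_ne_zero _ ha₄) ?_)
    · have h : ((4 : ℕ) : K) ≠ 0 := natCast_ne_zero_of_lt (K := K) (p := p) (by norm_num) (by omega)
      exact_mod_cast h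
    · exact cast_choose_ne_zero (K := K) (p := p) (by omega) (by omega)
  rw [← key] at hne
  intro hdvd
  apply hne
  obtain ⟨c, hc⟩ := hdvd
  rw [hc, Int.cast_mul, Int.cast_natCast, CharP.cast_eq_zero K p, zero_mul]

end WeierstrassCurve

end
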